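import Mathlib
import Literature.RepresentationTheory.Semisimple.FiniteFieldDescentAbsIrred
import Literature.RepresentationTheory.Semisimple.BrauerNesbitt
import Literature.RepresentationTheory.Semisimple.Semisimplification
import Literature.RepresentationTheory.Semisimple.SubrepresentationEquiv
import Literature.NumberTheory.GaloisRepresentations.ContinuousRep
import HarnessLib

/-!
# Route `PhantomRMYoshida`, crux `StableYoshidaCongruence` (stmt-Langlands-13640), line
# `burkhardt-weddle-two-three-anchor`: Stub 1 `stub_modelFp`, part I — plane representations and block sums

Pure representation theory over a field `k` (no topology) for the `𝔽_p`-descent of an `𝔽_p`-rational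
Yoshida pair (`…ModelFp.lean`), all in the sub-namespace `ModelFp`:

* `isIrreducible_of_charpoly_eq` — a matrix representation `ψ : G → GL₂(k)` with the characteristic
  polynomials of an IRREDUCIBLE `σ : G → GL₂(k)` is irreducible (a stable line would make `σ`
  Brauer–Nesbitt-equivalent to a sum `A ⊕ D` of two characters, which is reducible);
* `exists_conj_of_equiv` — equivalent matrix representations are conjugate (the tree's
  `FramedRep.exists_eq_conj_of_equiv` without the topology);
* `exists_conj_blockDiag` — if `ψ₁, ψ₂ : G → GL₂(k)` have the characteristic polynomials of the
  irreducible `σ, σ'`, the block sum `ψ₁ ⊕ ψ₂` is `GL₄(k)`-conjugate to `σ ⊕ σ'` (Brauer–Nesbitt, tree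
  `Representation.nonempty_equiv_of_charpoly_eq`, on the two semisimple block sums);
* `exists_mulVec_not_mem_span`, `exists_eigenvector_of_not_isIrreducible`,
  `isIrreducible_map_of_surjective` — irreducible plane representations have no common eigenvector,
  reducible ones do, and irreducibility survives a SURJECTIVE change of coefficients (the Frobenius of
  a perfect field).

Everything is proved from the tree (`BrauerNesbitt`, `Semisimplification`, `SubrepresentationEquiv`,
`FinTwoSemisimplification`); no named fact is used.  Worker of lead prover-line-stmt-Langlands-13640-c1-0
(2026-08-16).
-/

-- `Summit.Langlands.Langlands.…` (summit = sub-problem name, D-0017 layout) trips `dupNamespace` on every decl.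
set_option linter.dupNamespace false

noncomputable section

open Polynomial Matrix
open Literature.NumberTheory.GaloisRepresentations
open Literature.RepresentationTheory.Semisimple

namespace Summit.Langlands.Langlands.Cruxes.StableYoshidaCongruence.BurkhardtWeddleTwoThreeAnchor.ModelFp

variable {k : Type} [Field k] {G : Type} [Group G]

/-! ## Matrix representations `G → GL_n(k)` as representations on `kⁿ` -/

/-- The linear map of `g` in the representation on `kⁿ` through `ψ : G → GL_n(k)` is `v ↦ ψ(g) v`,
i.e. `Matrix.toLin'` of the matrix `ψ(g)`. [folklore] -/
theorem glStd_comp_apply {n : ℕ} (ψ : G →* GL (Fin n) k) (g : G) :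
    ((glStdRepresentation (Fin n) k).comp ψ) g =
      Matrix.toLin' ((ψ g : GL (Fin n) k) : Matrix (Fin n) (Fin n) k) :=
  LinearMap.ext fun _ => rfl

/-- The characteristic polynomial of `g` on `kⁿ` through `ψ` is `det(X - ψ(g))`. [folklore] -/
theorem charpoly_glStd_comp {n : ℕ} (ψ : G →* GL (Fin n) k) (g : G) :
    (((glStdRepresentation (Fin n) k).comp ψ) g).charpoly =
      ((ψ g : GL (Fin n) k) : Matrix (Fin n) (Fin n) k).charpoly := by
  rw [glStd_comp_apply, Matrix.charpoly_toLin']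

/-- An irreducible representation is semisimple (a simple lattice is complemented). [folklore] -/
theorem isSemisimpleRepresentation_of_isIrreducible {V : Type} [AddCommGroup V] [Module k V]
    (ρ : Representation k G V) (h : ρ.IsIrreducible) : ρ.IsSemisimpleRepresentation := by
  haveI : IsSimpleOrder (Subrepresentation ρ) := h
  infer_instance

/-- A representation which is not irreducible on a non-zero space has a proper non-zero
subrepresentation. [folklore] -/
theorem exists_ne_bot_ne_top_of_not_isIrreducible {V : Type} [AddCommGroup V] [Module k V]
    [Nontrivial V] (ρ : Representation k G V) (h : ¬ ρ.IsIrreducible) :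
    ∃ W : Subrepresentation ρ, W ≠ ⊥ ∧ W ≠ ⊤ := by
  by_contra hcon
  push Not at hcon
  have hbt : (⊥ : Subrepresentation ρ) ≠ ⊤ := by
    intro hh
    have h' : ((⊥ : Subrepresentation ρ).toSubmodule) = (⊤ : Subrepresentation ρ).toSubmodule := by
      rw [hh]
    exact bot_ne_top (α := Submodule k V) h'
  haveI : Nontrivial (Subrepresentation ρ) := ⟨⟨⊥, ⊤, hbt⟩⟩
  exact h ⟨fun W => or_iff_not_imp_left.mpr (hcon W)⟩

/-- A representation on a space of dimension `≤ 1` is semisimple (its only subrepresentations are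
`⊥` and `⊤`). [folklore] -/
theorem isSemisimpleRepresentation_of_finrank_le_one {V : Type} [AddCommGroup V] [Module k V]
    [FiniteDimensional k V] (hV : Module.finrank k V ≤ 1) (ρ : Representation k G V) :
    ρ.IsSemisimpleRepresentation := by
  refine ⟨fun W => ?_⟩
  by_cases hW : Module.finrank k W.toSubmodule = Module.finrank k V
  · have hWt : W = ⊤ := Subrepresentation.toSubmodule_injective (Submodule.eq_top_of_finrank_eq hW)
    exact ⟨⊥, hWt ▸ isCompl_top_bot⟩
  · have hlt := lt_of_le_of_ne (Submodule.finrank_le W.toSubmodule) hW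
    have h0 : Module.finrank k W.toSubmodule = 0 := by omega
    have hWb : W = ⊥ := Subrepresentation.toSubmodule_injective (Submodule.finrank_eq_zero.mp h0)
    exact ⟨⊤, hWb ▸ isCompl_bot_top⟩

/-! ## A plane representation with the characteristic polynomials of an irreducible one -/

/-- **A plane representation with the characteristic polynomials of an irreducible plane
representation is irreducible.**  If `ψ : G → GL₂(k)` had a proper non-zero stable subspace, the
diagonal blocks `A`, `D` (two characters; tree `exists_blocks_of_subrepresentation`) would give a
semisimple `A ⊕ D` with `det(X - A(g)) det(X - D(g)) = det(X - ψ(g)) = det(X - σ(g))`, hence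
`A ⊕ D ≃ σ` by Brauer–Nesbitt (tree `Representation.nonempty_equiv_of_charpoly_eq`), so `A ⊕ D` would
be irreducible — but `A ⊕ 0` is a proper non-zero subrepresentation. [folklore] -/
theorem isIrreducible_of_charpoly_eq (σ ψ : G →* GL (Fin 2) k)
    (hσ : Representation.IsIrreducible ((glStdRepresentation (Fin 2) k).comp σ))
    (h : ∀ g, ((ψ g : GL (Fin 2) k) : Matrix (Fin 2) (Fin 2) k).charpoly =
      ((σ g : GL (Fin 2) k) : Matrix (Fin 2) (Fin 2) k).charpoly) :
    Representation.IsIrreducible ((glStdRepresentation (Fin 2) k).comp ψ) := by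
  classical
  by_contra hirr
  obtain ⟨W, hW0, hW1⟩ := exists_ne_bot_ne_top_of_not_isIrreducible _ hirr
  obtain ⟨m, q, hm, hq, e, A, D, hcp, -, -⟩ := exists_blocks_of_subrepresentation ψ W hW0 hW1
  have hmq : m + q = 2 := by simpa using Fintype.card_congr e
  set RA : Representation k G (Fin m → k) := (glStdRepresentation (Fin m) k).comp A with hRA
  set RD : Representation k G (Fin q → k) := (glStdRepresentation (Fin q) k).comp D with hRD
  set Rσ : Representation k G (Fin 2 → k) := (glStdRepresentation (Fin 2) k).comp σ with hRσ
  haveI : RA.IsSemisimpleRepresentation :=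
    isSemisimpleRepresentation_of_finrank_le_one (by rw [Module.finrank_fin_fun]; omega) RA
  haveI : RD.IsSemisimpleRepresentation :=
    isSemisimpleRepresentation_of_finrank_le_one (by rw [Module.finrank_fin_fun]; omega) RD
  haveI : Rσ.IsIrreducible := hσ
  haveI : Rσ.IsSemisimpleRepresentation := isSemisimpleRepresentation_of_isIrreducible Rσ hσ
  have hc : ∀ g, ((RA.prod RD) g).charpoly = (Rσ g).charpoly := by
    intro g
    change ((RA g).prodMap (RD g)).charpoly = _
    rw [LinearMap.charpoly_prodMap, hRA, hRD, hRσ, charpoly_glStd_comp, charpoly_glStd_comp,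
      charpoly_glStd_comp, ← hcp, h]
  obtain ⟨e'⟩ := Representation.nonempty_equiv_of_charpoly_eq (RA.prod RD) Rσ hc
  have hirr' : (RA.prod RD).IsIrreducible := Representation.isIrreducible_of_equiv e'.symm
  have hm0 : 0 < m := by omega
  have hq0 : 0 < q := by omega
  set K := (Representation.IntertwiningMap.snd k RA RD).ker with hK
  rcases hirr'.eq_bot_or_eq_top K with hKb | hKt
  · have hmem : ((fun _ => (1 : k)), (0 : Fin q → k)) ∈ K := by
      rw [hK, Representation.IntertwiningMap.mem_ker]
      rfl
    rw [hKb] at hmem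
    have h0 : ((fun _ => (1 : k)), (0 : Fin q → k)) = (0 : (Fin m → k) × (Fin q → k)) :=
      (Submodule.mem_bot k).mp hmem
    have := congr_fun (Prod.mk.inj h0).1 ⟨0, hm0⟩
    simp at this
  · have hmem : ((0 : Fin m → k), fun _ => (1 : k)) ∈ K := by
      rw [hKt]; trivial
    rw [hK, Representation.IntertwiningMap.mem_ker] at hmem
    have h0 : (fun _ => (1 : k)) = (0 : Fin q → k) := hmem
    have := congr_fun h0 ⟨0, hq0⟩
    simp at this

/-! ## Equivalent matrix representations are conjugate -/

/-- **Equivalent matrix representations are conjugate**: an equivalence of the representations on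
`kⁿ` through `ψ, ψ' : G → GL_n(k)` exhibits `ψ'` as `P ψ P⁻¹` for the matrix `P` of the equivalence
(the tree's `FramedRep.exists_eq_conj_of_equiv`, minus the topology). [folklore] -/
theorem exists_conj_of_equiv {n : ℕ} (ψ ψ' : G →* GL (Fin n) k)
    (e : Representation.Equiv ((glStdRepresentation (Fin n) k).comp ψ)
      ((glStdRepresentation (Fin n) k).comp ψ')) :
    ∃ P : GL (Fin n) k, ∀ g, ψ' g = P * ψ g * P⁻¹ := by
  classical
  set E : Matrix (Fin n) (Fin n) k := LinearMap.toMatrix' e.toLinearEquiv.toLinearMap with hE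
  set E' : Matrix (Fin n) (Fin n) k := LinearMap.toMatrix' e.toLinearEquiv.symm.toLinearMap
    with hE'
  have hEE' : E * E' = 1 := by
    rw [hE, hE', ← LinearMap.toMatrix'_comp, ← LinearMap.toMatrix'_id]
    congr 1
    exact LinearMap.ext fun v ↦ e.toLinearEquiv.apply_symm_apply v
  have hE'E : E' * E = 1 := by
    rw [hE, hE', ← LinearMap.toMatrix'_comp, ← LinearMap.toMatrix'_id]
    congr 1
    exact LinearMap.ext fun v ↦ e.toLinearEquiv.symm_apply_apply v
  let P : GL (Fin n) k := ⟨E, E', hEE', hE'E⟩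
  refine ⟨P, fun g => ?_⟩
  have hcomm : E * ((ψ g : GL (Fin n) k) : Matrix (Fin n) (Fin n) k) =
      ((ψ' g : GL (Fin n) k) : Matrix (Fin n) (Fin n) k) * E := by
    apply Matrix.toLin'.injective
    refine LinearMap.ext fun v ↦ ?_
    rw [Matrix.toLin'_apply, Matrix.toLin'_apply, ← Matrix.mulVec_mulVec, ← Matrix.mulVec_mulVec,
      hE, LinearMap.toMatrix'_mulVec, LinearMap.toMatrix'_mulVec]
    exact Representation.IntertwiningMap.isIntertwining _ _ e.toIntertwiningMap g v
  refine Units.ext ?_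
  rw [Units.val_mul, Units.val_mul]
  change ((ψ' g : GL (Fin n) k) : Matrix (Fin n) (Fin n) k) = E * (ψ g : GL (Fin n) k) * E'
  rw [hcomm, mul_assoc, hEE', mul_one]

/-! ## Block sums of two plane representations -/

/-- **Conjugacy of block sums.**  If `ψ₁, ψ₂ : G → GL₂(k)` have the characteristic polynomials of the
irreducible `σ, σ' : G → GL₂(k)`, then the block sum `D = ψ₁ ⊕ ψ₂` is `GL₄(k)`-conjugate to the block sum
`σ ⊕ σ'`: both are semisimple (`isIrreducible_of_charpoly_eq`, tree
`isSemisimpleRepresentation_of_blockDiag`) with the same characteristic polynomials, hence equivalent by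
Brauer–Nesbitt (tree `Representation.nonempty_equiv_of_charpoly_eq`), hence conjugate
(`exists_conj_of_equiv`). [folklore] -/
theorem exists_conj_blockDiag :
    ∀ {k : Type} [Field k] {G : Type} [Group G] (σ σ' ψ₁ ψ₂ : G →* GL (Fin 2) k),
      Representation.IsIrreducible ((glStdRepresentation (Fin 2) k).comp σ) →
      Representation.IsIrreducible ((glStdRepresentation (Fin 2) k).comp σ') →
      (∀ g, ((ψ₁ g : GL (Fin 2) k) : Matrix (Fin 2) (Fin 2) k).charpoly =
        ((σ g : GL (Fin 2) k) : Matrix (Fin 2) (Fin 2) k).charpoly) →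
      (∀ g, ((ψ₂ g : GL (Fin 2) k) : Matrix (Fin 2) (Fin 2) k).charpoly =
        ((σ' g : GL (Fin 2) k) : Matrix (Fin 2) (Fin 2) k).charpoly) →
      ∀ (D : G →* GL (Fin 4) k),
      (∀ g, ((D g : GL (Fin 4) k) : Matrix (Fin 4) (Fin 4) k) =
        Matrix.reindex finSumFinEquiv finSumFinEquiv
          (Matrix.fromBlocks ((ψ₁ g : GL (Fin 2) k) : Matrix (Fin 2) (Fin 2) k) 0 0
            ((ψ₂ g : GL (Fin 2) k) : Matrix (Fin 2) (Fin 2) k))) →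
      ∃ Q : GL (Fin 4) k, ∀ g, ((Q⁻¹ * D g * Q : GL (Fin 4) k) : Matrix (Fin 4) (Fin 4) k) =
        Matrix.reindex finSumFinEquiv finSumFinEquiv
          (Matrix.fromBlocks ((σ g : GL (Fin 2) k) : Matrix (Fin 2) (Fin 2) k) 0 0
            ((σ' g : GL (Fin 2) k) : Matrix (Fin 2) (Fin 2) k)) := by
  intro k _ G _ σ σ' ψ₁ ψ₂ hσ hσ' h₁ h₂ D hD
  classical
  obtain ⟨B, hB⟩ := exists_blockDiag_hom (k := k) (finSumFinEquiv : Fin 2 ⊕ Fin 2 ≃ Fin 4) σ σ'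
  have hψ₁ := isIrreducible_of_charpoly_eq σ ψ₁ hσ h₁
  have hψ₂ := isIrreducible_of_charpoly_eq σ' ψ₂ hσ' h₂
  haveI hDss := isSemisimpleRepresentation_of_blockDiag (finSumFinEquiv : Fin 2 ⊕ Fin 2 ≃ Fin 4) hD
    (isSemisimpleRepresentation_of_isIrreducible _ hψ₁)
    (isSemisimpleRepresentation_of_isIrreducible _ hψ₂)
  haveI hBss := isSemisimpleRepresentation_of_blockDiag (finSumFinEquiv : Fin 2 ⊕ Fin 2 ≃ Fin 4) hB
    (isSemisimpleRepresentation_of_isIrreducible _ hσ)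
    (isSemisimpleRepresentation_of_isIrreducible _ hσ')
  have hc : ∀ g, (((glStdRepresentation (Fin 4) k).comp D) g).charpoly =
      (((glStdRepresentation (Fin 4) k).comp B) g).charpoly := by
    intro g
    rw [charpoly_glStd_comp, charpoly_glStd_comp, hD, hB, Matrix.charpoly_reindex,
      Matrix.charpoly_reindex, Matrix.charpoly_fromBlocks_zero₁₂, Matrix.charpoly_fromBlocks_zero₁₂,
      h₁, h₂]
  obtain ⟨e⟩ := Representation.nonempty_equiv_of_charpoly_eq _ _ hc
  obtain ⟨P, hP⟩ := exists_conj_of_equiv D B e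
  refine ⟨P⁻¹, fun g => ?_⟩
  rw [inv_inv, ← hP g, hB g]


/-! ## Plane representations: common eigenvectors and change of coefficients -/

section Eigen

variable {k' : Type} [Field k']

/-- An irreducible plane representation `ψ : G → GL₂(k)` has no common eigenvector: every line `k v`
is moved by some `ψ(g)`. [folklore] -/
theorem exists_mulVec_not_mem_span (ψ : G →* GL (Fin 2) k)
    (h : Representation.IsIrreducible ((glStdRepresentation (Fin 2) k).comp ψ)) {v : Fin 2 → k}
    (hv : v ≠ 0) : ∃ g, ((ψ g : GL (Fin 2) k) : Matrix (Fin 2) (Fin 2) k) *ᵥ v ∉ k ∙ v := by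
  by_contra hall
  push Not at hall
  let S : Subrepresentation ((glStdRepresentation (Fin 2) k).comp ψ) :=
    { toSubmodule := k ∙ v
      apply_mem_toSubmodule := fun g w hw => by
        obtain ⟨b, rfl⟩ := Submodule.mem_span_singleton.mp hw
        rw [map_smul]
        exact Submodule.smul_mem _ _ (hall g) }
  have hS1 : Module.finrank k (k ∙ v) = 1 := finrank_span_singleton hv
  rcases h.eq_bot_or_eq_top S with hb | ht
  · have h0 : (k ∙ v) = ⊥ := congrArg Subrepresentation.toSubmodule hb
    rw [Submodule.span_singleton_eq_bot] at h0
    exact hv h0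
  · have h0 : (k ∙ v) = ⊤ := congrArg Subrepresentation.toSubmodule ht
    rw [h0, finrank_top, Module.finrank_fin_fun] at hS1
    exact absurd hS1 (by norm_num)

/-- A plane representation `ψ : G → GL₂(k)` which is not irreducible has a common eigenvector (a
proper non-zero stable subspace is a line, spanned by any of its non-zero vectors). [folklore] -/
theorem exists_eigenvector_of_not_isIrreducible (ψ : G →* GL (Fin 2) k)
    (h : ¬ Representation.IsIrreducible ((glStdRepresentation (Fin 2) k).comp ψ)) :
    ∃ v : Fin 2 → k, v ≠ 0 ∧
      ∀ g, ((ψ g : GL (Fin 2) k) : Matrix (Fin 2) (Fin 2) k) *ᵥ v ∈ k ∙ v := by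
  obtain ⟨W, hW0, hW1⟩ := exists_ne_bot_ne_top_of_not_isIrreducible _ h
  have hbot : (⊥ : Subrepresentation ((glStdRepresentation (Fin 2) k).comp ψ)).toSubmodule = ⊥ := rfl
  have htop : (⊤ : Subrepresentation ((glStdRepresentation (Fin 2) k).comp ψ)).toSubmodule = ⊤ := rfl
  have hW0' : W.toSubmodule ≠ ⊥ := fun hh ↦
    hW0 (Subrepresentation.toSubmodule_injective (by rw [hh, hbot]))
  have hW1' : W.toSubmodule ≠ ⊤ := fun hh ↦
    hW1 (Subrepresentation.toSubmodule_injective (by rw [hh, htop]))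
  have hW1r : Module.finrank k W.toSubmodule = 1 := finrank_eq_one_of_ne_bot_of_ne_top hW0' hW1'
  obtain ⟨w, hwW, hw0⟩ := Submodule.exists_mem_ne_zero_of_ne_bot hW0'
  have hmult : ∀ u ∈ W.toSubmodule, ∃ c : k, c • w = u := by
    intro u hu
    have hw0' : (⟨w, hwW⟩ : W.toSubmodule) ≠ 0 := fun hh => hw0 (congrArg Subtype.val hh)
    obtain ⟨c, hc⟩ := (finrank_eq_one_iff_of_nonzero' (⟨w, hwW⟩ : W.toSubmodule) hw0').mp hW1r
      ⟨u, hu⟩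
    exact ⟨c, by simpa using congrArg Subtype.val hc⟩
  refine ⟨w, hw0, fun g => ?_⟩
  obtain ⟨c, hc⟩ := hmult _ (W.apply_mem_toSubmodule g hwW)
  exact Submodule.mem_span_singleton.mpr ⟨c, hc⟩

/-- **Irreducibility of a plane representation is preserved by a surjective change of
coefficients** `f : k → k'` (e.g. the Frobenius of a perfect field): a common eigenvector of the
`f(ψ(g))` pulls back along `f` to a common eigenvector of the `ψ(g)`. [folklore] -/
theorem isIrreducible_map_of_surjective (f : k →+* k') (hf : Function.Surjective f)
    (ψ : G →* GL (Fin 2) k)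
    (hψ : Representation.IsIrreducible ((glStdRepresentation (Fin 2) k).comp ψ)) :
    Representation.IsIrreducible
      ((glStdRepresentation (Fin 2) k').comp ((Matrix.GeneralLinearGroup.map f).comp ψ)) := by
  by_contra h
  obtain ⟨w, hw0, hw⟩ := exists_eigenvector_of_not_isIrreducible _ h
  choose v hv using fun i => hf (w i)
  have hvw : (⇑f ∘ v) = w := funext hv
  have hv0 : v ≠ 0 := by
    rintro rfl
    apply hw0
    rw [← hvw]
    funext i
    simp
  obtain ⟨g, hg⟩ := exists_mulVec_not_mem_span ψ hψ hv0
  obtain ⟨a, ha⟩ := Submodule.mem_span_singleton.mp (hw g)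
  obtain ⟨b, rfl⟩ := hf a
  apply hg
  refine Submodule.mem_span_singleton.mpr ⟨b, ?_⟩
  funext i
  apply f.injective
  have key := congr_fun ha i
  rw [← hvw] at key
  calc f ((b • v) i) = (f b • (⇑f ∘ v)) i := by simp [map_mul]
    _ = ((((Matrix.GeneralLinearGroup.map f).comp ψ g : GL (Fin 2) k') :
          Matrix (Fin 2) (Fin 2) k') *ᵥ (⇑f ∘ v)) i := key
    _ = f ((((ψ g : GL (Fin 2) k) : Matrix (Fin 2) (Fin 2) k) *ᵥ v) i) :=
          (RingHom.map_mulVec f _ v i).symm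

end Eigen

end Summit.Langlands.Langlands.Cruxes.StableYoshidaCongruence.BurkhardtWeddleTwoThreeAnchor.ModelFp

end
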